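import Summits.QuantumFields.YangMills.Theorems.BalabanUVNodesN15ColouredFluctuationCovariance
import Literature.MathematicalPhysics.QuantumFieldTheory.Balaban1983to89.B6Cov2156TorusSubset
import HarnessLib

/-!
# N15 = NE2 — PROGRAMME Ð (Ð-1): THE COLOURED (2.156) FLUCTUATION COVARIANCE WITH DIRICHLET ELIMINATION OUTSIDE A REGION — `C_S(C_SᵀAC_S)⁻¹C_Sᵀ`, `C_S = C_S^{b06} ⊗ₖ 1_ι`,
# for EVERY sub-family `S` of b06's remaining torus variables (in particular the Λ-bonds of every Λ = B(Λ′₀) ⊂ T): objects, letters, (2.153) ⊗ colour ON `S`, sandwich letters, consistency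
# (dag-n15-a g30, programme Ð «Dirichlet», FILE (Ð-1); node N15 = NE2; `--supports stmt-QuantumFields-27366 --as helper`, count-neutral; three plumbing `def`s + theorems)

WHY.  The discharge referee's MODEL→PRINT itemisation for the U-live unit conjunct on dag-n15-c's carrier (ref-B READ-989 (ii)) records that (L-1)…(L-4) work on the WHOLE unit torus
(`inΛ ≡ True`), whereas [B9] §E's unit-lattice propagator `C^{(k)}_Λ(U)` carries *«Dirichlet boundary conditions outside some domain Λ of the unit lattice»* (p.427): the quadratic form
(3.156) is *«considered on the subspace {B : B = 0 on Λᶜ, …}»* (p.428), parametrised by the remaining variables `B = CB̃` exactly as in [B6] (2.154)–(2.156), `C^{(k)}_Λ = C_Λ(C_Λ*Δ_kC_Λ)⁻¹C_Λ*`,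
and Thm 3.15's constants `B₀, δ₀` depend on `d` and `L` only — UNIFORMLY IN Λ.  The Literature already holds the Λ-elimination on the torus for the scalar bond field
(`B6Cov2156TorusSubset`: the column restriction `elimTS L M S hS` of b06's `elimT` to any sub-family `S` of the remaining variables, the Λ-bonds `lamFree L M Λ'₀` of `Λ = B(Λ′₀)`, Lemma 2.4's
bond convention, `lamFree_univ`).  This file tensors it with the colour and rebuilds (L-1)'s letters ON `S`, so that (Ð-2)∕(Ð-3) can run (L-2)∕(L-3)'s finite Combes–Thomas and `redCov_rate`
with ONE set of constants for every `S`, and (Ð-4) can state `NE2PlusUnit` with a GENUINE region predicate.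

WHAT.  §1 defs `elimCS L M ι S hS := elimTS L M S hS ⊗ₖ 1_ι`, `covCS L M ι S hS A := redCov (elimCS …) A` (= `C_S(C_SᵀAC_S)⁻¹C_Sᵀ`, a matrix on ALL coloured bonds, zero rows∕columns off the
Λ-bonds), `fdistS` (pseudo-metric on the kept coloured variables); `elimCS_apply`, `elimCS_eq_elimC` (every entry is one of (L-1)'s `elimC`), `elimCS_eq_submatrix`, `elimCS_mulVec`, ★ `elimCS_iso`,
`elimCS_range`, `elimCS_col` (`≤ 2`), `elimCS_row` (`≤ L^{d+1}`); ★ CONSISTENCY `elimCS_freeT`∕`covCS_freeT`∕`covCS_eq_covC_of_eq` (at `S` = all remaining variables the objects ARE (L-1)'s `elimC`∕`covC`)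
and `covCS_lamFree_eq_covC` (Λ′₀ ⊇ all coarse sites ⇒ the Dirichlet covariance of Λ is the torus one); `covCS_lamFree_apply_eq_zero` (p.250 «CB′ = 0 outside Λ»: the rows of `covCS` at the
Λ-bonds of `lamFree` VANISH at every coloured bond not meeting Λ).  §2 `sandwichTS_eq_submatrix` (`C_SᵀAC_S` is a principal submatrix of `C_ιᵀAC_ι`), `abs_sandwichTS_le`, `abs_sandwichS_le`, `fsumS_le`.
§3 ★ `coercive_sandwichCS` ((2.153) ⊗ colour ON `S`: `C_Sᵀ(Δ^{(n)}⊗1 + P)C_S` is `(γ′₀ − ζV)`-coercive — SAME constant as (L-1), for every `S`), `isUnit_sandwichCS`.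
Honest label: finite-dimensional linear algebra + bookkeeping over landed rows (b06's elimination and (2.153) on the torus, the Literature's subset elimination); NO layer of NE2 proved
here; no count.
[cite: Balaban1985BackgroundPropagators, §E pp.427–428 (Dirichlet region Λ, (3.155)–(3.158)), Thm 3.15 (3.187) p.432 (constants depend on d, L only); Balaban1984PropagatorsII, (2.152)–(2.157) pp.249–250 («or on a subset Λ ⊂ T^{(k)}», `C^{(k)}_Λ = C(C*Δ_kC)⁻¹C*`, «CB′ = 0 outside Λ»), Lemma 2.4 p.245 (Λ-bonds)]
-/

noncomputable section

open scoped BigOperators Matrix Kronecker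

namespace Summit.QuantumFields.YangMills.BalabanUVNodes.N15.UnitLayerBgCol

open Literature.MathematicalPhysics.QuantumFieldTheory.Balaban1983to89
open Literature.MathematicalPhysics.QuantumFieldTheory.Balaban1983to89.B6Lemma24Torus (pbox coarseSites)
open Literature.MathematicalPhysics.QuantumFieldTheory.Balaban1983to89.B6Cov2156Torus (freeT elimT deltaPol one_le_M represents_deltaPol lowerOnConstrainedT_of_represents gamma2153
  gamma2153_pos elimT_col)
open Literature.MathematicalPhysics.QuantumFieldTheory.Balaban1983to89.B6Cov2156TorusSubset (elimTS elimTS_iso elimTS_row q1_elimTS_mulVec elimTS_mulVec_tree IsLam lamFree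
  lamFree_subset lamFree_univ mem_lamFree elimT_eq_zero_of_not_isLam)
open Literature.MathematicalPhysics.QuantumFieldTheory.Balaban1983to89.B6LowerBound2153Torus (pos_of_neZero)
open Literature.MathematicalPhysics.QuantumFieldTheory.Balaban1983to89.T4Cov2156Rate (redCov)
open Literature.MathematicalPhysics.QuantumFieldTheory.Balaban1983to89.B4Sect5Proof (latticeConst latticeConst_nonneg)
open Literature.MathematicalPhysics.QuantumFieldTheory.Balaban1983to89.QGQInverse (Coercive isUnit_of_coercive form_abs_le_of_schur)
open Summit.QuantumFields.YangMills.BalabanUVNodes.N15.UnitLayerBg (rowSum_abs_le colSum_abs_le)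

variable {d : ℕ} (L : ℕ) (M : Fin (d + 1) → ℕ) [∀ μ, NeZero (M μ)] (ι : Type) [Fintype ι] [DecidableEq ι]

/-! ## §1 The coloured Dirichlet elimination, the Dirichlet covariance, letters, consistency -/

section Objects

variable (S : Finset (B4.Idx (pbox M) (d + 1))) (hS : S ⊆ freeT L M)

/-- **THE COLOURED ELIMINATION OF A SUB-FAMILY ∕ A DIRICHLET REGION**: `C_S := C_S^{b06} ⊗ₖ 1_ι` — the Literature's column restriction `elimTS L M S hS` of b06's p.250 elimination
matrix to a sub-family `S` of the remaining torus variables (for `S = lamFree L M Λ'₀`: the Λ-bonds of `Λ = B(Λ′₀)`, i.e. the substitution `B = C_ΛB̃` of [B9] (3.156)∕[B6] (2.154) with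
`B = 0` outside Λ), applied to every colour component. [cite: Balaban1984PropagatorsII, (2.154)–(2.156) pp.249–250; Balaban1985BackgroundPropagators, §E (3.156)–(3.158) p.428 (object)] -/
def elimCS : Matrix (B4.Idx (pbox M) (d + 1) × ι) (S × ι) ℝ := elimTS L M S hS ⊗ₖ (1 : Matrix ι ι ℝ)

/-- **THE COLOURED (2.156) COVARIANCE WITH DIRICHLET ELIMINATION**: `covCS A := C_S (C_Sᵀ A C_S)⁻¹ C_Sᵀ` (`T4Cov2156Rate.redCov`) — for `S = lamFree L M Λ'₀` the coloured
`C^{(k)}_Λ = C_Λ(C_Λ*Δ_kC_Λ)⁻¹C_Λ*` of the form `A`, a matrix on all coloured unit bonds (zero rows∕columns at the bonds not meeting Λ, `covCS_lamFree_apply_eq_zero`).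
[cite: Balaban1984PropagatorsII, (2.156) p.250 (object); Balaban1985BackgroundPropagators, (3.157)–(3.158) p.428, Thm 3.15 (3.185)–(3.187) p.432 (shape of `C^{(k)}_Λ(U)`)] -/
def covCS (A : Matrix (B4.Idx (pbox M) (d + 1) × ι) (B4.Idx (pbox M) (d + 1) × ι) ℝ) : Matrix (B4.Idx (pbox M) (d + 1) × ι) (B4.Idx (pbox M) (d + 1) × ι) ℝ :=
  redCov (elimCS L M ι S hS) A

/-- THE PSEUDO-METRIC ON THE KEPT COLOURED VARIABLES: `cdist` of the underlying coloured bonds. [folklore] -/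
def fdistS (k k' : S × ι) : ℝ := cdist M ι ((k.1 : B4.Idx (pbox M) (d + 1)), k.2) ((k'.1 : B4.Idx (pbox M) (d + 1)), k'.2)

/-- The kept coloured variables as coloured remaining variables of the torus (the column embedding; reducible). [folklore] -/
abbrev embS (k : S × ι) : freeT L M × ι := (⟨(k.1 : B4.Idx (pbox M) (d + 1)), hS k.1.2⟩, k.2)

variable {L M ι S hS}

omit [∀ μ, NeZero (M μ)] [Fintype ι] in
/-- entries of `C_S^{b06} ⊗ₖ 1`. [folklore] -/
theorem elimCS_apply (p : B4.Idx (pbox M) (d + 1) × ι) (k : S × ι) :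
    elimCS L M ι S hS p k = if p.2 = k.2 then elimT L M p.1 ⟨(k.1 : B4.Idx (pbox M) (d + 1)), hS k.1.2⟩ else 0 := by
  rw [elimCS, Matrix.kroneckerMap_apply, Matrix.one_apply, mul_ite, mul_one, mul_zero]; rfl

omit [∀ μ, NeZero (M μ)] [Fintype ι] in
/-- ★ every entry of the Dirichlet elimination is one of (L-1)'s `elimC` (at the embedded column). [folklore] -/
theorem elimCS_eq_elimC (p : B4.Idx (pbox M) (d + 1) × ι) (k : S × ι) :
    elimCS L M ι S hS p k = elimC L M ι p (⟨(k.1 : B4.Idx (pbox M) (d + 1)), hS k.1.2⟩, k.2) := by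
  rw [elimCS_apply, elimC_apply]

omit [∀ μ, NeZero (M μ)] [Fintype ι] in
/-- `C_S = C_ι` restricted to the columns `embS`. [folklore] -/
theorem elimCS_eq_submatrix : elimCS L M ι S hS = (elimC L M ι).submatrix id (embS L M ι S hS) := by
  ext p k; rw [Matrix.submatrix_apply, elimCS_eq_elimC]; rfl

omit [∀ μ, NeZero (M μ)] in
/-- `(C_S^{b06} ⊗ₖ 1) *ᵥ x` acts colour by colour. [folklore] -/
theorem elimCS_mulVec (x : S × ι → ℝ) (p : B4.Idx (pbox M) (d + 1) × ι) :
    (elimCS L M ι S hS *ᵥ x) p = (elimTS L M S hS *ᵥ fun k => x (k, p.2)) p.1 := by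
  rw [Matrix.mulVec, Matrix.mulVec, dotProduct, dotProduct, Fintype.sum_prod_type]
  refine Finset.sum_congr rfl fun k _ => ?_
  rw [Finset.sum_eq_single p.2]
  · rw [elimCS_apply, if_pos rfl]; rfl
  · intro j _ hj; rw [elimCS_apply, if_neg (Ne.symm hj), zero_mul]
  · intro h; exact absurd (Finset.mem_univ _) h

omit [∀ μ, NeZero (M μ)] in
/-- ★ `‖x‖² ≤ ‖C_S x‖²` — the second inequality of (2.157) for the sub-family, colour by colour (Literature `elimTS_iso`). [cite: Balaban1984PropagatorsII, (2.157) p.250] -/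
theorem elimCS_iso (x : S × ι → ℝ) : x ⬝ᵥ x ≤ (elimCS L M ι S hS *ᵥ x) ⬝ᵥ (elimCS L M ι S hS *ᵥ x) := by
  rw [dot_self_eq_sum_colour x, dot_self_eq_sum_colour (elimCS L M ι S hS *ᵥ x)]
  refine Finset.sum_le_sum fun i _ => ?_
  have h := elimTS_iso hS (fun k => x (k, i))
  have e1 : (fun k => x (k, i)) ⬝ᵥ (fun k => x (k, i)) = ∑ k, x (k, i) ^ 2 := by simp only [dotProduct, pow_two]
  have e2 : (fun a => (elimCS L M ι S hS *ᵥ x) (a, i)) ⬝ᵥ (fun a => (elimCS L M ι S hS *ᵥ x) (a, i)) = ∑ p, (elimTS L M S hS *ᵥ fun k => x (k, i)) p ^ 2 := by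
    simp only [dotProduct, pow_two, elimCS_mulVec]
  rw [e1, e2]; exact h

omit [Fintype ι] in
/-- ★ RANGE of `C_S`: a nonzero entry links coloured bonds at periodic distance `≤ L − 1` ((L-1) `elimC_range`). [cite: Balaban1984PropagatorsII, p.250] -/
theorem elimCS_range (hL : 0 < L) {p : B4.Idx (pbox M) (d + 1) × ι} {k : S × ι} (h : elimCS L M ι S hS p k ≠ 0) :
    cdist M ι p ((k.1 : B4.Idx (pbox M) (d + 1)), k.2) ≤ (L : ℝ) - 1 := by
  rw [elimCS_eq_elimC] at h
  have h2 := elimC_range hL h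
  dsimp only at h2
  exact h2

omit [∀ μ, NeZero (M μ)] in
/-- COLUMN SUMS of `C_S`: `Σ_p |C_S(p,k)| ≤ 2` ((L-1) `elimC_col`: a column of `C_S` is a column of `C_ι`). [cite: Balaban1984PropagatorsII, p.250] -/
theorem elimCS_col (hL : 0 < L) (hLM : ∀ μ, L ∣ M μ) (k : S × ι) : ∑ p, |elimCS L M ι S hS p k| ≤ 2 := by
  simp_rw [elimCS_eq_elimC]
  exact elimC_col hL hLM _

omit [∀ μ, NeZero (M μ)] in
/-- ROW SUMS of `C_S`: `Σ_k |C_S(p,k)| ≤ L^{d+1}` (Literature `elimTS_row`: a sub-sum of b06's row). [cite: Balaban1984PropagatorsII, p.250] -/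
theorem elimCS_row (hL : 0 < L) (p : B4.Idx (pbox M) (d + 1) × ι) : ∑ k, |elimCS L M ι S hS p k| ≤ (L : ℝ) ^ (d + 1) := by
  rw [Fintype.sum_prod_type]
  calc ∑ f, ∑ j, |elimCS L M ι S hS p (f, j)| = ∑ f, |elimTS L M S hS p.1 f| := Finset.sum_congr rfl fun f _ => by
          rw [Finset.sum_eq_single p.2]
          · rw [elimCS_apply, if_pos rfl]; rfl
          · intro j _ hj; rw [elimCS_apply, if_neg (Ne.symm hj), abs_zero]
          · intro h; exact absurd (Finset.mem_univ _) h
    _ ≤ (L : ℝ) ^ (d + 1) := elimTS_row hS hL p.1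

omit [∀ μ, NeZero (M μ)] [Fintype ι] in
/-- ★ **CONSISTENCY — AT `S` = ALL REMAINING VARIABLES THE DIRICHLET ELIMINATION IS (L-1)'s `C_ι`.** [folklore] -/
theorem elimCS_freeT (h : freeT L M ⊆ freeT L M) : elimCS L M ι (freeT L M) h = elimC L M ι := by
  ext p k; rw [elimCS_eq_elimC]

omit [∀ μ, NeZero (M μ)] in
/-- ★ **CONSISTENCY — AT `S` = ALL REMAINING VARIABLES THE DIRICHLET COVARIANCE IS (L-1)'s `covC`** (whole torus, no Dirichlet condition). [cite: Balaban1984PropagatorsII, (2.156) p.250] -/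
theorem covCS_freeT (h : freeT L M ⊆ freeT L M) (A : Matrix (B4.Idx (pbox M) (d + 1) × ι) (B4.Idx (pbox M) (d + 1) × ι) ℝ) :
    covCS L M ι (freeT L M) h A = covC L M ι A := by
  rw [covCS, elimCS_freeT]; rfl

omit [∀ μ, NeZero (M μ)] in
/-- The same for any sub-family that happens to be the whole one. [folklore] -/
theorem covCS_eq_covC_of_eq (hSe : S = freeT L M) (A : Matrix (B4.Idx (pbox M) (d + 1) × ι) (B4.Idx (pbox M) (d + 1) × ι) ℝ) :
    covCS L M ι S hS A = covC L M ι A := by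
  subst hSe; exact covCS_freeT hS A

/-- ★ **Λ = B(Λ′₀) WITH Λ′₀ ⊇ ALL COARSE SITES IS THE WHOLE TORUS**: the Dirichlet covariance of the Λ-bonds is then (L-1)'s `covC` (Literature `lamFree_univ`). [cite: Balaban1984PropagatorsII, (2.156) p.250] -/
theorem covCS_lamFree_eq_covC (hL : 0 < L) {Λ'₀ : Finset (Fin (d + 1) → ℤ)} (hΛ : coarseSites L M ⊆ Λ'₀)
    (A : Matrix (B4.Idx (pbox M) (d + 1) × ι) (B4.Idx (pbox M) (d + 1) × ι) ℝ) :
    covCS L M ι (lamFree L M Λ'₀) (lamFree_subset L M Λ'₀) A = covC L M ι A :=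
  covCS_eq_covC_of_eq (lamFree_univ hL hΛ) A

/-- **p.250 «CB′ = 0 OUTSIDE Λ» AT THE LEVEL OF THE COLOURED COVARIANCE**: for `S = lamFree L M Λ'₀` (the Λ-bonds of `Λ = B(Λ′₀)`, Lemma 2.4's convention: at least one end-point in Λ) the row of
`covCS` at a coloured bond `p` NOT meeting Λ vanishes identically (Literature `elimT_eq_zero_of_not_isLam`) — the Dirichlet covariance is the Λ × Λ matrix padded with zeros. [cite: Balaban1984PropagatorsII, p.250; Lemma 2.4 p.245 (Λ-bonds)] -/
theorem covCS_lamFree_apply_eq_zero (hL : 0 < L) (hLM : ∀ μ, L ∣ M μ) (Λ'₀ : Finset (Fin (d + 1) → ℤ))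
    (A : Matrix (B4.Idx (pbox M) (d + 1) × ι) (B4.Idx (pbox M) (d + 1) × ι) ℝ) {p : B4.Idx (pbox M) (d + 1) × ι} (hp : ¬ IsLam L M Λ'₀ p.1)
    (q : B4.Idx (pbox M) (d + 1) × ι) : covCS L M ι (lamFree L M Λ'₀) (lamFree_subset L M Λ'₀) A p q = 0 := by
  have h0 : ∀ k : lamFree L M Λ'₀ × ι, elimCS L M ι (lamFree L M Λ'₀) (lamFree_subset L M Λ'₀) p k = 0 := fun k => by
    rw [elimCS_apply]
    split_ifs
    · have hk := mem_lamFree.1 k.1.2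
      exact elimT_eq_zero_of_not_isLam hL (pos_of_neZero M) hLM hp hk.1 hk.2
    · rfl
  rw [covCS, redCov, Matrix.mul_assoc, Matrix.mul_apply]
  exact Finset.sum_eq_zero fun k _ => by rw [h0 k, zero_mul]

end Objects

/-! ## §2 Sandwich letters on the sub-family -/

section Sandwich

variable {L M ι} {S : Finset (B4.Idx (pbox M) (d + 1))} {hS : S ⊆ freeT L M}

omit [Fintype ι] [DecidableEq ι] in
/-- `fdistS` is `cdist` of the underlying coloured bonds (unfolding). [folklore] -/
theorem fdistS_eq (k k' : S × ι) : fdistS M ι S k k' = cdist M ι ((k.1 : B4.Idx (pbox M) (d + 1)), k.2) ((k'.1 : B4.Idx (pbox M) (d + 1)), k'.2) := rfl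

omit [Fintype ι] [DecidableEq ι] in
/-- `fdistS k k′ = fdist (embS k) (embS k′)` (projections reduced by `dsimp`, so that no unfolding of `freeT` is ever attempted by the unifier). [folklore] -/
theorem fdistS_eq_fdist (k k' : S × ι) : fdistS M ι S k k' = fdist L M ι (embS L M ι S hS k) (embS L M ι S hS k') := by
  dsimp only [fdistS, fdist, embS]

omit [∀ μ, NeZero (M μ)] in
/-- ★ `C_SᵀAC_S` IS A PRINCIPAL SUBMATRIX OF `C_ιᵀAC_ι` (columns `embS`). [folklore] -/
theorem sandwichTS_eq_submatrix (A : Matrix (B4.Idx (pbox M) (d + 1) × ι) (B4.Idx (pbox M) (d + 1) × ι) ℝ) :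
    (elimCS L M ι S hS)ᵀ * A * elimCS L M ι S hS = ((elimC L M ι)ᵀ * A * elimC L M ι).submatrix (embS L M ι S hS) (embS L M ι S hS) := by
  rw [elimCS_eq_submatrix, Matrix.transpose_submatrix, Matrix.submatrix_mul _ _ _ id _ Function.bijective_id, Matrix.submatrix_mul _ _ _ id _ Function.bijective_id,
    Matrix.submatrix_id_id]

omit [DecidableEq ι] in
/-- ROW SUMS ON THE KEPT COLOURED VARIABLES: `Σ_{k′} e^{−a·fdistS(k,k′)} ≤ |ι|·(d+1)·K_{d+1}(a)` (a sub-sum of (G) `colSum_le`). [cite: Balaban1984PropagatorsII, Lemma 2.1 (2.61) p.234 (lattice sums)] -/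
theorem fsumS_le {a : ℝ} (ha : 0 < a) (k : S × ι) :
    ∑ k' : S × ι, Real.exp (-(a * fdistS M ι S k k')) ≤ Fintype.card ι * (((d : ℝ) + 1) * latticeConst (d + 1) a) := by
  let e : S × ι ↪ B4.Idx (pbox M) (d + 1) × ι := ⟨fun k' => ((k'.1 : B4.Idx (pbox M) (d + 1)), k'.2), fun k₁ k₂ h => by
    simp only [Prod.mk.injEq] at h
    exact Prod.ext (Subtype.ext h.1) h.2⟩
  have hsub : ∑ k' : S × ι, Real.exp (-(a * fdistS M ι S k k')) ≤ ∑ q : B4.Idx (pbox M) (d + 1) × ι, Real.exp (-(a * cdist M ι ((k.1 : B4.Idx (pbox M) (d + 1)), k.2) q)) := by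
    calc ∑ k' : S × ι, Real.exp (-(a * fdistS M ι S k k')) = ∑ q ∈ (Finset.univ : Finset (S × ι)).map e, Real.exp (-(a * cdist M ι ((k.1 : B4.Idx (pbox M) (d + 1)), k.2) q)) := by
          rw [Finset.sum_map]; rfl
      _ ≤ _ := Finset.sum_le_univ_sum_of_nonneg fun q => (Real.exp_pos _).le
  exact hsub.trans (colSum_le M ι ha _)

/-- ★ **`|C_Sᵀ A C_S (k,k′)| ≤ 4·c_A·e^{2κ(L−1)}·e^{−κ·fdistS(k,k′)}`** for `|A(p,q)| ≤ c_A e^{−κ·cdist}` (`κ ≥ 0`) — (L-1) `abs_sandwichT_le` at the embedded variables. [cite: Balaban1984PropagatorsII, p.250 («C*Δ_kC has the same exponential decay as Δ_k»)] -/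
theorem abs_sandwichTS_le (hL : 0 < L) (hLM : ∀ μ, L ∣ M μ) {A : Matrix (B4.Idx (pbox M) (d + 1) × ι) (B4.Idx (pbox M) (d + 1) × ι) ℝ} {cA κ : ℝ} (hcA : 0 ≤ cA) (hκ : 0 ≤ κ)
    (hA : ∀ p q, |A p q| ≤ cA * Real.exp (-(κ * cdist M ι p q))) (k k' : S × ι) :
    |((elimCS L M ι S hS)ᵀ * A * elimCS L M ι S hS) k k'| ≤ 4 * cA * Real.exp (2 * κ * ((L : ℝ) - 1)) * Real.exp (-(κ * fdistS M ι S k k')) := by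
  rw [sandwichTS_eq_submatrix, Matrix.submatrix_apply, fdistS_eq_fdist (hS := hS)]
  exact abs_sandwichT_le hL hLM hcA hκ hA (embS L M ι S hS k) (embS L M ι S hS k')

/-- ★ **`|C_S X C_Sᵀ (p,q)| ≤ L^{2(d+1)}·c_X·e^{2κ(L−1)}·e^{−κ·cdist(p,q)}`** for `|X(k,k′)| ≤ c_X e^{−κ·fdistS}` (`κ ≥ 0`; row sums `≤ L^{d+1}`, range `≤ L − 1`) — (L-1) `abs_sandwich_le`'s proof on the
kept variables. [cite: Balaban1984PropagatorsII, p.250] -/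
theorem abs_sandwichS_le (hL : 0 < L) {X : Matrix (S × ι) (S × ι) ℝ} {cX κ : ℝ} (hcX : 0 ≤ cX) (hκ : 0 ≤ κ)
    (hX : ∀ k k', |X k k'| ≤ cX * Real.exp (-(κ * fdistS M ι S k k'))) (p q : B4.Idx (pbox M) (d + 1) × ι) :
    |(elimCS L M ι S hS * X * (elimCS L M ι S hS)ᵀ) p q| ≤ ((L : ℝ) ^ (d + 1)) ^ 2 * cX * Real.exp (2 * κ * ((L : ℝ) - 1)) * Real.exp (-(κ * cdist M ι p q)) := by
  have hterm : ∀ k k', |elimCS L M ι S hS p k * X k k' * elimCS L M ι S hS q k'| ≤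
      |elimCS L M ι S hS p k| * |elimCS L M ι S hS q k'| * (cX * Real.exp (2 * κ * ((L : ℝ) - 1)) * Real.exp (-(κ * cdist M ι p q))) := by
    intro k k'
    rw [abs_mul, abs_mul]
    by_cases hp : elimCS L M ι S hS p k = 0
    · simp [hp]
    by_cases hq : elimCS L M ι S hS q k' = 0
    · simp [hq]
    have hrp := elimCS_range hL hp
    have hrq := elimCS_range hL hq
    have htri : cdist M ι p q ≤ fdistS M ι S k k' + 2 * ((L : ℝ) - 1) := by
      rw [fdistS_eq]
      have h1 := cdist_triangle M ι p ((k.1 : B4.Idx (pbox M) (d + 1)), k.2) q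
      have h2 := cdist_triangle M ι ((k.1 : B4.Idx (pbox M) (d + 1)), k.2) ((k'.1 : B4.Idx (pbox M) (d + 1)), k'.2) q
      rw [cdist_comm M ι q] at hrq
      have h3 := cdist_comm M ι ((k'.1 : B4.Idx (pbox M) (d + 1)), k'.2) q
      linarith
    have hexp : Real.exp (-(κ * fdistS M ι S k k')) ≤ Real.exp (2 * κ * ((L : ℝ) - 1)) * Real.exp (-(κ * cdist M ι p q)) := by
      rw [← Real.exp_add]; exact Real.exp_le_exp.mpr (by nlinarith)
    calc |elimCS L M ι S hS p k| * |X k k'| * |elimCS L M ι S hS q k'| ≤ |elimCS L M ι S hS p k| * (cX * Real.exp (-(κ * fdistS M ι S k k'))) * |elimCS L M ι S hS q k'| :=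
          mul_le_mul_of_nonneg_right (mul_le_mul_of_nonneg_left (hX k k') (abs_nonneg _)) (abs_nonneg _)
      _ ≤ |elimCS L M ι S hS p k| * (cX * (Real.exp (2 * κ * ((L : ℝ) - 1)) * Real.exp (-(κ * cdist M ι p q)))) * |elimCS L M ι S hS q k'| :=
          mul_le_mul_of_nonneg_right (mul_le_mul_of_nonneg_left (mul_le_mul_of_nonneg_left hexp hcX) (abs_nonneg _)) (abs_nonneg _)
      _ = _ := by ring
  have hrow := elimCS_row (ι := ι) (hS := hS) hL p
  have hrow' := elimCS_row (ι := ι) (hS := hS) hL q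
  have hLd : (0 : ℝ) ≤ (L : ℝ) ^ (d + 1) := by positivity
  rw [Matrix.mul_apply]
  calc |∑ k', (elimCS L M ι S hS * X) p k' * (elimCS L M ι S hS)ᵀ k' q|
      ≤ ∑ k', |(elimCS L M ι S hS * X) p k' * (elimCS L M ι S hS)ᵀ k' q| := Finset.abs_sum_le_sum_abs _ _
    _ ≤ ∑ k', ∑ k, |elimCS L M ι S hS p k| * |elimCS L M ι S hS q k'| * (cX * Real.exp (2 * κ * ((L : ℝ) - 1)) * Real.exp (-(κ * cdist M ι p q))) := by
        refine Finset.sum_le_sum fun k' _ => ?_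
        rw [Matrix.mul_apply, Finset.sum_mul, Matrix.transpose_apply]
        refine (Finset.abs_sum_le_sum_abs _ _).trans (Finset.sum_le_sum fun k _ => hterm k k')
    _ = (∑ k, |elimCS L M ι S hS p k|) * (∑ k', |elimCS L M ι S hS q k'|) * (cX * Real.exp (2 * κ * ((L : ℝ) - 1)) * Real.exp (-(κ * cdist M ι p q))) := by
        rw [Finset.sum_comm, Finset.sum_mul, Finset.sum_mul]
        refine Finset.sum_congr rfl fun k _ => ?_
        rw [Finset.mul_sum, Finset.sum_mul]
    _ ≤ (L : ℝ) ^ (d + 1) * (L : ℝ) ^ (d + 1) * (cX * Real.exp (2 * κ * ((L : ℝ) - 1)) * Real.exp (-(κ * cdist M ι p q))) := by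
        have h0 : 0 ≤ cX * Real.exp (2 * κ * ((L : ℝ) - 1)) * Real.exp (-(κ * cdist M ι p q)) := by positivity
        exact mul_le_mul_of_nonneg_right (mul_le_mul hrow hrow' (Finset.sum_nonneg fun _ _ => abs_nonneg _) hLd) h0
    _ = _ := by ring

end Sandwich

/-! ## §3 Positivity: (2.153) ⊗ colour on the sub-family — same constant for every `S` -/

section Positivity

variable {L M ι} {S : Finset (B4.Idx (pbox M) (d + 1))} {hS : S ⊆ freeT L M}

/-- ★ **(2.153) ⊗ COLOUR + A DECAYING PERTURBATION, ON A SUB-FAMILY ∕ DIRICHLET REGION**: for `d ≥ 1`, `L ≥ 1`, `L ∣ M`, `n ≥ 1` and a coloured perturbation `|P(p,q)| ≤ ζe^{−δ·cdist}` with row sums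
`Σ_q e^{−δ cdist} ≤ V`, `ζV ≤ γ′₀ = gamma2153 (d+1) L`:  `C_Sᵀ (Δ^{(n)} ⊗ₖ 1 + P) C_S` is `(γ′₀ − ζV)`-coercive on the kept coloured variables, for EVERY sub-family `S` — (2.153) on the torus
colour by colour at `B = C_SB̃` (which satisfies the constraints: Literature `q1_elimTS_mulVec`, `elimTS_mulVec_tree`), `‖B̃‖ ≤ ‖C_SB̃‖` (`elimCS_iso`), the finite Schur test for `P`.
The constant does not see `S`: this is the uniformity in Λ of [B9] Thm 3.15 at the level of (2.157). [cite: Balaban1984PropagatorsII, (2.153) p.249, (2.157) p.250; Balaban1985BackgroundPropagators, p.428 («lower bound γ₀ > 0 independent of k»), Thm 3.15 p.432] -/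
theorem coercive_sandwichCS (hd : 1 ≤ d) (hL : 1 ≤ L) (hLM : ∀ μ, L ∣ M μ) {n : ℕ} (hn : 1 ≤ n)
    {P : Matrix (B4.Idx (pbox M) (d + 1) × ι) (B4.Idx (pbox M) (d + 1) × ι) ℝ} {ζ δ V : ℝ} (hζ : 0 ≤ ζ) (hV0 : 0 ≤ V)
    (hP : ∀ p q, |P p q| ≤ ζ * Real.exp (-(δ * cdist M ι p q))) (hV : ∀ p, ∑ q, Real.exp (-(δ * cdist M ι p q)) ≤ V) (hζV : ζ * V ≤ gamma2153 (d + 1) L) :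
    Coercive ((elimCS L M ι S hS)ᵀ * (deltaPol M n ⊗ₖ (1 : Matrix ι ι ℝ) + P) * elimCS L M ι S hS) (gamma2153 (d + 1) L - ζ * V) := by
  have hL0 : 0 < L := hL
  have hl := lowerOnConstrainedT_of_represents M (by omega) hL n hn hLM (represents_deltaPol M n)
  intro x
  set y := elimCS L M ι S hS *ᵥ x with hy
  -- `x ⬝ W x = y ⬝ (Δ⊗1 + P) y`
  have hform : x ⬝ᵥ (((elimCS L M ι S hS)ᵀ * (deltaPol M n ⊗ₖ (1 : Matrix ι ι ℝ) + P) * elimCS L M ι S hS) *ᵥ x) =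
      y ⬝ᵥ ((deltaPol M n ⊗ₖ (1 : Matrix ι ι ℝ)) *ᵥ y) + y ⬝ᵥ (P *ᵥ y) := by
    rw [← Matrix.mulVec_mulVec, ← Matrix.mulVec_mulVec, Matrix.dotProduct_mulVec, Matrix.vecMul_transpose, ← hy, Matrix.add_mulVec, dotProduct_add]
  -- (2.153) colour by colour: `y ⬝ (Δ⊗1) y ≥ γ′₀ ‖y‖²`
  have hΔ : gamma2153 (d + 1) L * (y ⬝ᵥ y) ≤ y ⬝ᵥ ((deltaPol M n ⊗ₖ (1 : Matrix ι ι ℝ)) *ᵥ y) := by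
    rw [dot_kron_one_mulVec, dot_self_eq_sum_colour y, Finset.mul_sum]
    refine Finset.sum_le_sum fun i _ => ?_
    have hyi : (fun a => y (a, i)) = elimTS L M S hS *ᵥ fun k => x (k, i) := funext fun a => by rw [hy, elimCS_mulVec]
    rw [hyi]
    have h := hl (elimTS L M S hS *ᵥ fun k => x (k, i)) (fun c hc => q1_elimTS_mulVec hS hL0 hLM _ hc) (fun p hp => elimTS_mulVec_tree hS _ hp)
    have e1 : (elimTS L M S hS *ᵥ fun k => x (k, i)) ⬝ᵥ (elimTS L M S hS *ᵥ fun k => x (k, i)) = ∑ p, (elimTS L M S hS *ᵥ fun k => x (k, i)) p ^ 2 := by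
      simp only [dotProduct, pow_two]
    have e2 : (elimTS L M S hS *ᵥ fun k => x (k, i)) ⬝ᵥ (deltaPol M n *ᵥ (elimTS L M S hS *ᵥ fun k => x (k, i))) =
        ∑ p, (elimTS L M S hS *ᵥ fun k => x (k, i)) p * (deltaPol M n *ᵥ (elimTS L M S hS *ᵥ fun k => x (k, i))) p := rfl
    rw [e1, e2]; exact h
  -- the perturbation: `|y ⬝ P y| ≤ ζV ‖y‖²`
  have hPf : |y ⬝ᵥ (P *ᵥ y)| ≤ ζ * V * (y ⬝ᵥ y) :=
    form_abs_le_of_schur P (ρ := ζ * V) (mul_nonneg hζ hV0) (le_of_eq (pow_two _).symm)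
      (rowSum_abs_le (cdist M ι) hζ hP hV) (colSum_abs_le (cdist M ι) (cdist_comm M ι) hζ hP hV) y
  have hPl : -(ζ * V * (y ⬝ᵥ y)) ≤ y ⬝ᵥ (P *ᵥ y) := by have := neg_abs_le (y ⬝ᵥ (P *ᵥ y)); linarith
  -- `‖x‖² ≤ ‖y‖²`
  have hiso : x ⬝ᵥ x ≤ y ⬝ᵥ y := elimCS_iso x
  have hγ0 : 0 ≤ gamma2153 (d + 1) L - ζ * V := by linarith
  rw [hform]
  nlinarith [mul_le_mul_of_nonneg_left hiso hγ0]

/-- **(2.157) WITH COLOUR ON A SUB-FAMILY — `C_Sᵀ(Δ^{(n)}⊗1 + P)C_S` IS INVERTIBLE** below the threshold `ζV < γ′₀`, for every `S`. [cite: Balaban1984PropagatorsII, (2.157) p.250 (shape); Balaban1985BackgroundPropagators, (3.158) p.428] -/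
theorem isUnit_sandwichCS (hd : 1 ≤ d) (hL : 1 ≤ L) (hLM : ∀ μ, L ∣ M μ) {n : ℕ} (hn : 1 ≤ n)
    {P : Matrix (B4.Idx (pbox M) (d + 1) × ι) (B4.Idx (pbox M) (d + 1) × ι) ℝ} {ζ δ V : ℝ} (hζ : 0 ≤ ζ) (hV0 : 0 ≤ V)
    (hP : ∀ p q, |P p q| ≤ ζ * Real.exp (-(δ * cdist M ι p q))) (hV : ∀ p, ∑ q, Real.exp (-(δ * cdist M ι p q)) ≤ V) (hζV : ζ * V < gamma2153 (d + 1) L) :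
    IsUnit ((elimCS L M ι S hS)ᵀ * (deltaPol M n ⊗ₖ (1 : Matrix ι ι ℝ) + P) * elimCS L M ι S hS).det :=
  (Matrix.isUnit_iff_isUnit_det _).mp (isUnit_of_coercive (by linarith) (coercive_sandwichCS hd hL hLM hn hζ hV0 hP hV hζV.le))

end Positivity

end Summit.QuantumFields.YangMills.BalabanUVNodes.N15.UnitLayerBgCol

end
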